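import Literature.AlgebraicGeometry.HodgeTheory.MonomialSupportedHypersurfaceNoInvariantsTorus
import Literature.AlgebraicGeometry.HodgeTheory.MonomialSupportedHypersurfaceNoInvariants
import Literature.AlgebraicGeometry.HodgeTheory.BettiUniverseAxioms
import HarnessLib

/-!
# K1-B piece NOINV of crux `VeryGeneralSignCommutatorsInHg` (route `SignSymmetricPowers`, stmt-HodgeConjecture-19716):
# no monodromy invariants on `H³` — UNCONDITIONALLY (the global invariant cycle theorem is no longer used)

Prover seat `hodge-nonav-19716-p2` (g6), cell `hodge-nonav`. Landed `--supports stmt-HodgeConjecture-19716` (helper);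
sorry-free, no definition, no named fact.

The registered stub `stub_signNoInvariants` of the line `andre-zariski` (landed as
`SignSymmetricPowersNoInvariants.stub_signNoInvariants`, p562551) has the shape
`deligne_globalInvariantCycles → NOINV`, and the crux K1-B was therefore conditional on Deligne's global invariant cycle
theorem — in registry v15 through the binder h423 `voisin2003_rangeRestrict_eq_of_compactification` (Voisin II Prop. 4.23),
consumed ONLY here (`deligne_globalInvariantCycles_of_rangeRestrict h423 ↦ hGIC ↦ stub_signNoInvariants hGIC`).

This file proves the CONCLUSION `NOINV` outright: for every even `d ≥ 4` and every member `𝒴_t` of the family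
`familyM ℂ 3 d M` of smooth degree-`d` threefolds in `ℙ⁴` supported on the ι-even monomials `M = {m | m₀ + m₁ even}`,
the rational monodromy group has no non-zero invariant in `H³(𝒴_t; ℚ)`. The proof is the Literature theorem
`UniversalHypersurface.familyM_ratInvariant_eq_zero_of_fermat` (`MonomialSupportedHypersurfaceNoInvariantsTorus`):
the base `S_M(ℂ)` is path connected, so invariants transport to the Fermat point `[Σ xᵢᵈ]` (ι-even as `d` is even —
`isBasePointFree_setOf_even_add`); there every diagonal symmetry `a ∈ μ_d⁵` acts as a MONODROMY transformation (the
torus trick, `DiagonalTorus.diagonalAut_conj_mem_ratMonodromyGroup_familyM`: the loop `s ↦ [Σ b_s,ᵢ^d xᵢ^d]`,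
`b_s = exp(s·log a)`); and `μ_d⁵`-invariants of `H³(X³_d; ℂ)` vanish (`V(0) = ⊥` in odd degree, Shioda).

* `signNoInvariants` — the registered binder text of `stub_signNoInvariants` WITHOUT its antecedent (the registered
  text itself, `deligne_globalInvariantCycles → …`, is then `fun _ => signNoInvariants`; it is not restated here).

Consequence (companion `SignSymmetricPowersFourFactsTorus`): K1-B ⟸ {hpg3 ∕ PG, hPL, hCDK, hB2}; h423 is discharged
from the crux. CONDITIONAL crux; nothing here says HC ∕ HC_AV is proved; rung F-H1 is not moved.

## References

* [Shioda1979HodgeFermat] T. Shioda, The Hodge conjecture for Fermat varieties, Math. Ann. 245 (1979), §1.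
* [Katz2009] N. M. Katz, Another look at the Dwork family, Progr. Math. 269 (2009), §3.
* [VoisinHodgeII2003] C. Voisin, Hodge Theory and Complex Algebraic Geometry II (CUP 2003), §3.1.2 (and Thm. 4.24,
  Cor. 4.25 for the statement being replaced).
-/

noncomputable section

set_option linter.dupNamespace false

open CategoryTheory AlgebraicGeometry
open Literature.AlgebraicTopology.SingularHomology
open Literature.AlgebraicGeometry.Motives Literature.AlgebraicGeometry.Motives.UniversalHypersurface
open Literature.AlgebraicGeometry.HodgeTheory Literature.AlgebraicGeometry.HodgeTheory.UniversalHypersurface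
open Literature.AlgebraicGeometry.HodgeTheory.BettiUniverse

namespace Summit.HodgeConjecture.HodgeConjecture.Theorems.SignSymmetricPowersNoInvariantsTorus

/-- **NOINV, unconditionally** — the registered binder text of `stub_signNoInvariants` (K1-B line `andre-zariski`) WITHOUT
its antecedent `deligne_globalInvariantCycles`: for every even `d ≥ 4` and every complex point `t` of the base `S_M` of
the ι-even family `familyM ℂ 3 d M` (`M = {m | m₀ + m₁ even}`), every class `x ∈ H³(𝒴_t; ℚ)` fixed by the whole
rational monodromy group `Γ_t` is zero.  Proof: `familyM_ratInvariant_eq_zero_of_fermat` with `3 = 2·1 + 1` and `M`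
base-point free (`isBasePointFree_setOf_even_add`). [cite: Shioda1979HodgeFermat, §1 (1.3)–(1.4)] [cite: Katz2009, §3]
[cite: VoisinHodgeII2003, §3.1.2] -/
theorem signNoInvariants :
    open Literature.AlgebraicGeometry.Motives Literature.AlgebraicGeometry.Motives.UniversalHypersurface Literature.AlgebraicGeometry.HodgeTheory Literature.AlgebraicGeometry.HodgeTheory.UniversalHypersurface Literature.AlgebraicGeometry.HodgeTheory.BettiUniverse CategoryTheory.Limits in ∀ ⦃d : ℕ⦄, Even d → ∀ (h4 : 4 ≤ d), (let M : Set (DegIndex 3 d) := {m | Even (m.1 0 + m.1 1)}; let u := familyM ℂ 3 d M; let hu : IsSmoothProjectiveFamily u 3 := isSmoothProjectiveFamily_familyM ℂ 3 d M (by decide) (le_trans (by decide) h4); let hU : IsCohomologicallyLocallyTrivialOn u (Set.univ : Set (ComplexPoints (baseM ℂ 3 d M))) := isCohomologicallyLocallyTrivialOn_familyM 3 d M (by decide) (le_trans (by decide) h4); ∀ (t : ComplexPoints (baseM ℂ 3 d M)), let Y := fiberOver u t; let hY : IsSmoothProjective 3 Y := hu.isSmoothProjective t; let Γ := (haveI :=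 finite hY 3; ratMonodromyGroup u 3 hU ⟨t, Set.mem_univ _⟩); ∀ x : bettiCohomology Y 3, (∀ g ∈ Γ, g x = x) → x = 0) := by
  intro d hev h4 M u hu hU t Y hY Γ x hx
  exact familyM_ratInvariant_eq_zero_of_fermat (p := 1) (isBasePointFree_setOf_even_add (n := 3) hev)
    (le_trans (by decide) h4) hU t x hx

end Summit.HodgeConjecture.HodgeConjecture.Theorems.SignSymmetricPowersNoInvariantsTorus

end
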